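import Summits.Ventures.Crystal3D.Theorems.StickyWulffConstantTextureBuildSlabPlatesJoint
import HarnessLib

/-!
# TB-1 brick: the PLATE WINDOW OF A WALL PIECE — one common slab index, the merged window of all its cells, and ONE collar-defect set with the joint pigeonhole bound
# (lane T, crux `TextureLiminfV5`, stmt-Ventures-23912; memo HOME/wulff-p2/g25/SLAB-PLATES-g25.md §3, §9 (1)–(2), §10)

HONEST FRAMING. Venture `Summits/Ventures/Crystal3D` (cell `crystal3d-full`), route `route-Ventures-StickyWulffConstant`, helper `--supports` the
law-v5 crux `TextureLiminfV5` (stmt-Ventures-23912).  Pure finite bookkeeping (census-free, standard axioms) over '…SlabPlatesJoint' and '…SlabPlates'.  No cover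
is built; F-C1 not moved.

WHY.  Per grain side of a connected wall piece the constructor must hand `exists_site_heal_family_collar` ('…HealCollar') ONE window `W_f` (the union of the cells'
slab windows — neighbouring cells' windows are closer than `4`, so they cannot be separate windows) and collar sets `B_f, J_f`.  This file builds them: the common
slab index `k` of the joint pigeonhole, `W :=` the union over the cells `c` of `{w ∈ P c : φ c w ∈ [a₀ c + k(t+7), a₀ c + k(t+7) + t]}`, and ONE finite set `B`
(the union of the cells' collar bands of their defect sets `Dfx c`) that serves as BOTH collar sets, with `m·#B ≤ Σ_c #(Dfx c)`.

* **`exists_piece_window`** — the statement above; its last two clauses are VERBATIM the hypotheses `hB`, `hJ` of `exists_site_heal_collar` /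
  `exists_site_heal_family_collar` for the window `W`.
-/

noncomputable section

namespace Summit.Ventures.Crystal3D.Theorems

open Finset Summit.Ventures.Crystal3D
open Summit.Ventures.Crystal3D.Cruxes.TextureLiminf.TexShadow (E3)

variable {N : ℕ}

open scoped Classical in
/-- **THE PLATE WINDOW OF A WALL PIECE.**  See the module docstring. -/
theorem exists_piece_window {ι : Type*} (x : Fin N → E3) (S : Set E3) (cells : Finset ι) (P Dfx : ι → Finset E3)
    (φ : ι → E3 → ℝ) (hφ : ∀ c, ∀ p q : E3, |φ c p - φ c q| ≤ dist p q) (a₀ : ι → ℝ) (t : ℝ) (ht : 0 ≤ t) {m : ℕ} (hm : 0 < m)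
    (hDv : ∀ c ∈ cells, ∀ w, w ∈ S → w ∉ Set.range x → (∃ p ∈ P c, dist w p < 3) → w ∈ Dfx c)
    (hDb : ∀ c ∈ cells, ∀ b, b ∈ Set.range x → b ∉ S → (∃ p ∈ P c, dist b p < 3) → b ∈ Dfx c) :
    ∃ (k : ℕ) (W B : Finset E3), k < m ∧
      (∀ w, w ∈ W ↔ ∃ c ∈ cells, w ∈ P c ∧ a₀ c + k * (t + 7) ≤ φ c w ∧ φ c w ≤ a₀ c + k * (t + 7) + t) ∧
      (m : ℝ) * (B.card : ℝ) ≤ ∑ c ∈ cells, ((Dfx c).card : ℝ) ∧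
      (∀ w, w ∈ S → w ∉ W → w ∉ Set.range x → (∃ w₀ ∈ W, dist w w₀ < 3) → w ∈ B) ∧
      (∀ b, b ∈ Set.range x → b ∉ S → (∀ w ∈ W, 1 ≤ dist b w) → (∃ w₀ ∈ W, dist b w₀ < 2) → b ∈ B) := by
  classical
  obtain ⟨k, hk, hle⟩ := exists_joint_band_card_le cells Dfx φ a₀ t ht hm
  set W : Finset E3 := cells.biUnion fun c => (P c).filter fun w => a₀ c + k * (t + 7) ≤ φ c w ∧ φ c w ≤ a₀ c + k * (t + 7) + t with hW
  set B : Finset E3 := cells.biUnion fun c => (Dfx c).filter fun d =>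
    a₀ c + k * (t + 7) - 3 ≤ φ c d ∧ φ c d ≤ a₀ c + k * (t + 7) + t + 3 with hB
  have hmemW : ∀ w, w ∈ W ↔ ∃ c ∈ cells, w ∈ P c ∧ a₀ c + k * (t + 7) ≤ φ c w ∧ φ c w ≤ a₀ c + k * (t + 7) + t := by
    intro w
    simp only [hW, Finset.mem_biUnion, Finset.mem_filter]
  -- a point within `< r ≤ 3` of `W` lies in the collar band of the cell whose window it is near
  have near : ∀ (y : E3) (r : ℝ), r ≤ 3 → (∃ w₀ ∈ W, dist y w₀ < r) →
      ∃ c ∈ cells, (∃ p ∈ P c, dist y p < 3) ∧ a₀ c + k * (t + 7) - 3 ≤ φ c y ∧ φ c y ≤ a₀ c + k * (t + 7) + t + 3 := by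
    rintro y r hr ⟨w₀, hw₀, hd⟩
    obtain ⟨c, hc, hP, h1, h2⟩ := (hmemW w₀).1 hw₀
    refine ⟨c, hc, ⟨w₀, hP, by linarith⟩, ?_, ?_⟩
    · have h := hφ c y w₀; rw [abs_le] at h; linarith [h.1]
    · have h := hφ c y w₀; rw [abs_le] at h; linarith [h.2]
  refine ⟨k, W, B, hk, hmemW, ?_, ?_, ?_⟩
  · calc (m : ℝ) * (B.card : ℝ)
        ≤ (m : ℝ) * ∑ c ∈ cells, (((Dfx c).filter fun d =>
            a₀ c + k * (t + 7) - 3 ≤ φ c d ∧ φ c d ≤ a₀ c + k * (t + 7) + t + 3).card : ℝ) := by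
          gcongr
          exact_mod_cast Finset.card_biUnion_le
      _ ≤ ∑ c ∈ cells, ((Dfx c).card : ℝ) := hle
  · intro w hwS _ hwx hnear
    obtain ⟨c, hc, hP, h1, h2⟩ := near w 3 le_rfl hnear
    rw [hB, Finset.mem_biUnion]
    exact ⟨c, hc, Finset.mem_filter.2 ⟨hDv c hc w hwS hwx hP, h1, h2⟩⟩
  · intro b hbx hbS _ hnear
    obtain ⟨c, hc, hP, h1, h2⟩ := near b 2 (by norm_num) hnear
    rw [hB, Finset.mem_biUnion]
    exact ⟨c, hc, Finset.mem_filter.2 ⟨hDb c hc b hbx hbS hP, h1, h2⟩⟩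

end Summit.Ventures.Crystal3D.Theorems

end
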